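import Summits.Ventures.YMGap.RobustBall.StarDoorZdGeometric
import Summits.Ventures.YMGap.RobustBall.ThreePointDecayS
import Summits.Ventures.YMGap.RobustBall.DirectionalSusceptibilityStar
import HarnessLib

/-!
# Venture YMGap, track ROBUST-BALL (Y2) — THROUGH THE STAR DOOR: TREE DECAY OF THE THIRD CUMULANT OF ARBITRARY LOCAL OBSERVABLES
# (the star twin of `ThreePointDecayS`; the `SU(2)` Wilson point for EVERY `0 ≤ β_W ≤ 1/3`)

HONEST FRAMING. WHAT THIS IS: a venture file (cell `pub-ymgap`, track Y2 ROBUST-BALL, seat rb-p1, theorems only): the STAR-DOOR twin of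
`ThreePointDecayS.lean`.  Setting of `StarDoorZdGeometric.abs_covariance_le_of_starWindowBoundZdR_geometric`: a specification `γ` on `ℤ^d`
with quasilocal vertex-star kernels of radius `D ≥ 1`, a star window bound with received sum `0 ≤ ρ < 1` (Frobenius weight), ANY Gibbs measure
`μ` of `γ`; three ARBITRARY bounded measurable local observables `f, g, h` (supports `Δ_•`, Frobenius-Lipschitz vectors `δ_•`, bounds `M_•`);
`u₃(f; g; h) := cov(fg, h) − ⟨f⟩cov(g, h) − ⟨g⟩cov(f, h)`; `ρ' := max(ρ, ½)`, `t := log(1/ρ')/(D+2)`: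
* `abs_cov_mul_le_star` — `|cov_μ(fg, h)| ≤ 8N (M_f Σδ_g + M_g Σδ_f)(Σδ_h) ρ^{⌊d(Δ_f ∪ Δ_g, Δ_h)/(D+2)⌋}`;
* ★ `abs_threePoint_le_split_star` — ONE SPLIT: `|u₃(f; g; h)| ≤ 16N (M_f Σδ_g + M_g Σδ_f)(Σδ_h) ρ^{⌊d(Δ_f ∪ Δ_g, Δ_h)/(D+2)⌋}`;
* ★★ `abs_threePoint_le_tree_star` — TREE DECAY: with `B₃ := (M_fΣδ_g + M_gΣδ_f)Σδ_h + (M_fΣδ_h + M_hΣδ_f)Σδ_g + (M_gΣδ_h + M_hΣδ_g)Σδ_f`, `s = t/3`: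
  `|u₃(f; g; h)| ≤ 16N ρ'⁻¹ B₃ (e^{−s d(Δ_f,Δ_h)} + e^{−s d(Δ_g,Δ_h)})(e^{−s d(Δ_f,Δ_g)} + e^{−s d(Δ_h,Δ_g)})(e^{−s d(Δ_g,Δ_f)} + e^{−s d(Δ_h,Δ_f)})` — the
  three Dobrushin–Shlosman splits through the star door (`threePoint_swap` / `threePoint_rotate`), the floor powers dominated by exponentials
  (`pow_floor_le_exp`), the best split decaying in the mean of the three union distances, every union distance dominating the minimum of two
  set distances: every monomial is a TREE exponential through the three supports;
* `abs_threePoint_le_tree_of_member` — the same for the DLR states of a tier-1 member `(W, supp)` (continuous own-link terms of range `R`,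
  `D ≥ R + 2`) carrying a star window bound;
* ★ `su2_wilson_abs_threePoint_le_tree_upTo_oneThird` — `SU(2)`, `ℤ⁴`, THE WILSON POINT FOR EVERY `0 ≤ β_W ≤ 1/3` (received sum `≤ 399/400`, `D = 3`,
  `t = log(400/399)/5`), every DLR state, Lipschitz cylinders `F, G, H`: tree decay of `u₃(F; G; H)` with constant `32·(400/399)·B₃` — the per-term
  input of the second-order plaquette susceptibility and of `C²` in the coupling on the whole segment (successor files).
WHAT THIS IS NOT: sharp for large supports; the rate `log(400/399)/15` at the frontier is a one-sided comparison rate; lattice strong coupling only;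
nothing about the continuum limit or a Clay-sense mass gap.
-/

noncomputable section

open MeasureTheory Function Finset ProbabilityTheory Real
open scoped NNReal
open Literature.Probability.LatticeModels
open Literature.Probability.LatticeModels.DobrushinMetric
open Literature.MathematicalPhysics.QuantumLattice
open Literature.MathematicalPhysics.QuantumFieldTheory hiding ZdEdge
open Literature.MathematicalPhysics.QuantumFieldTheory.Balaban1983to89.StrongCouplingDobrushinWindow (OneLinkKRModulus)
open Summit.Ventures.YMGap.CouplingResponse (abs_threePoint_le threePoint_swap threePoint_rotate exp_neg_mul_min_le)
open Summit.Ventures.YMGap.DSWindowZd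
open Summit.Ventures.YMGap.StarResolventDim (gaugeR doorPoly Delta)

namespace Summit.Ventures.YMGap.RobustBall

variable {d N : ℕ}

/-- Floor powers are antitone in the distance: `x ≤ y`, `0 ≤ ρ ≤ 1` ⇒ `ρ^{⌊y/k⌋} ≤ ρ^{⌊x/k⌋}`. -/
theorem pow_floor_div_antitone {ρ x y : ℝ} (hρ0 : 0 ≤ ρ) (hρ1 : ρ ≤ 1) (k : ℕ) (hxy : x ≤ y) :
    ρ ^ ⌊y / k⌋₊ ≤ ρ ^ ⌊x / k⌋₊ :=
  pow_le_pow_of_le_one hρ0 hρ1 (Nat.floor_le_floor (div_le_div_of_nonneg_right hxy (Nat.cast_nonneg k)))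

/-! ### The third cumulant through the star door (specification level) -/

section Star

variable {γ : Specification (ZdEdge d) (SUN N)} {D : ℕ} {ρ : ℝ} {μ : Measure (LGConfig d (SUN N))}

/-- **The star door's covariance bound for a product observable**: specification `γ` with quasilocal star kernels of radius `D ≥ 1`, star
window bound with received sum `0 ≤ ρ < 1`, Gibbs measure `μ`; then
`|cov_μ(fg, h)| ≤ 8N (M_f Σδ_g + M_g Σδ_f)(Σδ_h) ρ^{⌊d(Δ_f ∪ Δ_g, Δ_h)/(D+2)⌋}`. -/
theorem abs_cov_mul_le_star (hγ : IsSpecification γ) (hD : 1 ≤ D)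
    (hloc : ∀ (c : ZdEdge d) (ζ ζ' : LGConfig d (SUN N)), (∀ v ∈ starNbhdZdR D c.1, ζ v = ζ' v) →
      ∀ (f : LGConfig d (SUN N) → ℝ), Measurable f → (∃ B, ∀ σ, |f σ| ≤ B) →
        DependsOn f (starWinZd c : Set (ZdEdge d)) →
        ∫ σ, f σ ∂(γ (starWinZd c) ζ) = ∫ σ, f σ ∂(γ (starWinZd c) ζ'))
    (hρ0 : 0 ≤ ρ) (hρ1 : ρ < 1) (hwin : StarWindowBoundZdR d N γ D ρ suFrobDist) (hμ : IsGibbsMeasure γ μ)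
    {f : LGConfig d (SUN N) → ℝ} (hfm : Measurable f) {Δf : Finset (ZdEdge d)}
    (hfdep : DependsOn f (↑Δf : Set (ZdEdge d))) {Mf : ℝ} (hMf : ∀ σ, |f σ| ≤ Mf) {δf : ZdEdge d → ℝ} (hδf : IsLipBound suFrobDist f δf)
    {g : LGConfig d (SUN N) → ℝ} (hgm : Measurable g) {Δg : Finset (ZdEdge d)}
    (hgdep : DependsOn g (↑Δg : Set (ZdEdge d))) {Mg : ℝ} (hMg : ∀ σ, |g σ| ≤ Mg) {δg : ZdEdge d → ℝ} (hδg : IsLipBound suFrobDist g δg)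
    {h : LGConfig d (SUN N) → ℝ} (hhm : Measurable h) {Δh : Finset (ZdEdge d)}
    (hhdep : DependsOn h (↑Δh : Set (ZdEdge d))) {Mh : ℝ} (hMh : ∀ σ, |h σ| ≤ Mh) {δh : ZdEdge d → ℝ} (hδh : IsLipBound suFrobDist h δh) :
    |cov[fun σ => f σ * g σ, h; μ]| ≤
      8 * N * (Mf * ∑ y ∈ Δg, δg y + Mg * ∑ y ∈ Δf, δf y) * (∑ y ∈ Δh, δh y) * ρ ^ ⌊setDistEdges (Δf ∪ Δg) Δh / (D + 2 : ℕ)⌋₊ := by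
  classical
  have hMf0 : 0 ≤ Mf := (abs_nonneg _).trans (hMf 1)
  have hMg0 : 0 ≤ Mg := (abs_nonneg _).trans (hMg 1)
  have hpm : Measurable fun σ => f σ * g σ := hfm.mul hgm
  have hMp : ∀ σ, |f σ * g σ| ≤ Mf * Mg := fun σ => by rw [abs_mul]; exact mul_le_mul (hMf σ) (hMg σ) (abs_nonneg _) hMf0
  have h1 := abs_covariance_le_of_starWindowBoundZdR_geometric hγ hD hloc hρ0 hρ1 hwin hμ hpm hhm hMp hMh
    (dependsOn_mul_union' hfdep hgdep) hhdep
    (isLipBound_mul_restrict (fun _ _ => suFrobDist_nonneg _ _) hfdep hgdep hMf hMg hMf0 hMg0 hδf hδg) hδh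
  have h4N : (2 * Real.sqrt N) ^ 2 = 4 * N := by rw [mul_pow, Real.sq_sqrt (Nat.cast_nonneg N)]; norm_num
  rw [sum_union_mul_restrict, h4N] at h1
  refine h1.trans (le_of_eq ?_)
  ring

/-- ★ **ONE SPLIT OF THE THIRD CUMULANT THROUGH THE STAR DOOR (`h` isolated).**  Under the hypotheses of `abs_cov_mul_le_star`:
`|cov(fg, h) − ⟨f⟩cov(g, h) − ⟨g⟩cov(f, h)| ≤ 16N (M_f Σδ_g + M_g Σδ_f)(Σδ_h) ρ^{⌊d(Δ_f ∪ Δ_g, Δ_h)/(D+2)⌋}`. -/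
theorem abs_threePoint_le_split_star (hγ : IsSpecification γ) (hD : 1 ≤ D)
    (hloc : ∀ (c : ZdEdge d) (ζ ζ' : LGConfig d (SUN N)), (∀ v ∈ starNbhdZdR D c.1, ζ v = ζ' v) →
      ∀ (f : LGConfig d (SUN N) → ℝ), Measurable f → (∃ B, ∀ σ, |f σ| ≤ B) →
        DependsOn f (starWinZd c : Set (ZdEdge d)) →
        ∫ σ, f σ ∂(γ (starWinZd c) ζ) = ∫ σ, f σ ∂(γ (starWinZd c) ζ'))
    (hρ0 : 0 ≤ ρ) (hρ1 : ρ < 1) (hwin : StarWindowBoundZdR d N γ D ρ suFrobDist) (hμ : IsGibbsMeasure γ μ)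
    {f : LGConfig d (SUN N) → ℝ} (hfm : Measurable f) {Δf : Finset (ZdEdge d)}
    (hfdep : DependsOn f (↑Δf : Set (ZdEdge d))) {Mf : ℝ} (hMf : ∀ σ, |f σ| ≤ Mf) {δf : ZdEdge d → ℝ} (hδf : IsLipBound suFrobDist f δf)
    {g : LGConfig d (SUN N) → ℝ} (hgm : Measurable g) {Δg : Finset (ZdEdge d)}
    (hgdep : DependsOn g (↑Δg : Set (ZdEdge d))) {Mg : ℝ} (hMg : ∀ σ, |g σ| ≤ Mg) {δg : ZdEdge d → ℝ} (hδg : IsLipBound suFrobDist g δg)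
    {h : LGConfig d (SUN N) → ℝ} (hhm : Measurable h) {Δh : Finset (ZdEdge d)}
    (hhdep : DependsOn h (↑Δh : Set (ZdEdge d))) {Mh : ℝ} (hMh : ∀ σ, |h σ| ≤ Mh) {δh : ZdEdge d → ℝ} (hδh : IsLipBound suFrobDist h δh) :
    |cov[fun σ => f σ * g σ, h; μ] - (∫ σ, f σ ∂μ) * cov[g, h; μ] - (∫ σ, g σ ∂μ) * cov[f, h; μ]| ≤
      16 * N * (Mf * ∑ y ∈ Δg, δg y + Mg * ∑ y ∈ Δf, δf y) * (∑ y ∈ Δh, δh y) * ρ ^ ⌊setDistEdges (Δf ∪ Δg) Δh / (D + 2 : ℕ)⌋₊ := by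
  classical
  haveI := hμ.isProbabilityMeasure
  have hMf0 : 0 ≤ Mf := (abs_nonneg _).trans (hMf 1)
  have hMg0 : 0 ≤ Mg := (abs_nonneg _).trans (hMg 1)
  have hSf : 0 ≤ ∑ y ∈ Δf, δf y := sum_nonneg fun y _ => hδf.nonneg y
  have hSg : 0 ≤ ∑ y ∈ Δg, δg y := sum_nonneg fun y _ => hδg.nonneg y
  have hSh : 0 ≤ ∑ y ∈ Δh, δh y := sum_nonneg fun y _ => hδh.nonneg y
  have h4N : (2 * Real.sqrt N) ^ 2 = 4 * N := by rw [mul_pow, Real.sq_sqrt (Nat.cast_nonneg N)]; norm_num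
  -- the three covariance bounds
  have e1 := abs_cov_mul_le_star hγ hD hloc hρ0 hρ1 hwin hμ hfm hfdep hMf hδf hgm hgdep hMg hδg hhm hhdep hMh hδh
  have e2 := abs_covariance_le_of_starWindowBoundZdR_geometric hγ hD hloc hρ0 hρ1 hwin hμ hgm hhm hMg hMh hgdep hhdep hδg hδh
  have e3 := abs_covariance_le_of_starWindowBoundZdR_geometric hγ hD hloc hρ0 hρ1 hwin hμ hfm hhm hMf hMh hfdep hhdep hδf hδh
  rw [h4N] at e2 e3
  -- the two single-observable distances dominate the union distance (or the bound vanishes)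
  obtain ⟨E, hE⟩ : ∃ E : ℝ, E = ρ ^ ⌊setDistEdges (Δf ∪ Δg) Δh / (D + 2 : ℕ)⌋₊ := ⟨_, rfl⟩
  rw [← hE] at e1 ⊢
  have hE0 : 0 ≤ E := by rw [hE]; exact pow_nonneg hρ0 _
  have e2' : Mf * |cov[g, h; μ]| ≤ Mf * (8 * N * (∑ y ∈ Δg, δg y) * (∑ y ∈ Δh, δh y) * E) := by
    refine mul_le_mul_of_nonneg_left (e2.trans ?_) hMf0
    by_cases hg0 : Δg.Nonempty
    · by_cases hh0 : Δh.Nonempty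
      · have hmono : ρ ^ ⌊setDistEdges Δg Δh / (D + 2 : ℕ)⌋₊ ≤ E := by
          rw [hE]; exact pow_floor_div_antitone hρ0 hρ1.le _ (setDistEdges_union_le_right Δf hg0 hh0)
        calc 2 * (4 * (N : ℝ)) * ρ ^ ⌊setDistEdges Δg Δh / (D + 2 : ℕ)⌋₊ * (∑ y ∈ Δg, δg y) * (∑ y ∈ Δh, δh y)
            ≤ 2 * (4 * (N : ℝ)) * E * (∑ y ∈ Δg, δg y) * (∑ y ∈ Δh, δh y) := by gcongr
          _ = _ := by ring
      · simp [Finset.not_nonempty_iff_eq_empty.1 hh0]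
    · simp [Finset.not_nonempty_iff_eq_empty.1 hg0]
  have e3' : Mg * |cov[f, h; μ]| ≤ Mg * (8 * N * (∑ y ∈ Δf, δf y) * (∑ y ∈ Δh, δh y) * E) := by
    refine mul_le_mul_of_nonneg_left (e3.trans ?_) hMg0
    by_cases hf0 : Δf.Nonempty
    · by_cases hh0 : Δh.Nonempty
      · have hmono : ρ ^ ⌊setDistEdges Δf Δh / (D + 2 : ℕ)⌋₊ ≤ E := by
          rw [hE]; exact pow_floor_div_antitone hρ0 hρ1.le _ (setDistEdges_union_le_left Δg hf0 hh0)
        calc 2 * (4 * (N : ℝ)) * ρ ^ ⌊setDistEdges Δf Δh / (D + 2 : ℕ)⌋₊ * (∑ y ∈ Δf, δf y) * (∑ y ∈ Δh, δh y)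
            ≤ 2 * (4 * (N : ℝ)) * E * (∑ y ∈ Δf, δf y) * (∑ y ∈ Δh, δh y) := by gcongr
          _ = _ := by ring
      · simp [Finset.not_nonempty_iff_eq_empty.1 hh0]
    · simp [Finset.not_nonempty_iff_eq_empty.1 hf0]
  calc |cov[fun σ => f σ * g σ, h; μ] - (∫ σ, f σ ∂μ) * cov[g, h; μ] - (∫ σ, g σ ∂μ) * cov[f, h; μ]|
      ≤ |cov[fun σ => f σ * g σ, h; μ]| + Mf * |cov[g, h; μ]| + Mg * |cov[f, h; μ]| := abs_threePoint_le hMf hMg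
    _ ≤ 8 * N * (Mf * ∑ y ∈ Δg, δg y + Mg * ∑ y ∈ Δf, δf y) * (∑ y ∈ Δh, δh y) * E +
          Mf * (8 * N * (∑ y ∈ Δg, δg y) * (∑ y ∈ Δh, δh y) * E) + Mg * (8 * N * (∑ y ∈ Δf, δf y) * (∑ y ∈ Δh, δh y) * E) :=
        add_le_add (add_le_add e1 e2') e3'
    _ = 16 * N * (Mf * ∑ y ∈ Δg, δg y + Mg * ∑ y ∈ Δf, δf y) * (∑ y ∈ Δh, δh y) * E := by ring

/-- ★★ **TREE DECAY OF THE THIRD CUMULANT THROUGH THE STAR DOOR.**  Under the hypotheses of `abs_cov_mul_le_star`, with `ρ' := max(ρ, ½)`,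
`t = log(1/ρ')/(D+2)` (passed as an equation), `s := t/3` and
`B₃ := (M_fΣδ_g + M_gΣδ_f)Σδ_h + (M_fΣδ_h + M_hΣδ_f)Σδ_g + (M_gΣδ_h + M_hΣδ_g)Σδ_f`:
`|u₃(f; g; h)| ≤ 16N ρ'⁻¹ B₃ · (e^{−s d(Δ_f,Δ_h)} + e^{−s d(Δ_g,Δ_h)}) (e^{−s d(Δ_f,Δ_g)} + e^{−s d(Δ_h,Δ_g)}) (e^{−s d(Δ_g,Δ_f)} + e^{−s d(Δ_h,Δ_f)})`. -/
theorem abs_threePoint_le_tree_star (hγ : IsSpecification γ) (hD : 1 ≤ D)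
    (hloc : ∀ (c : ZdEdge d) (ζ ζ' : LGConfig d (SUN N)), (∀ v ∈ starNbhdZdR D c.1, ζ v = ζ' v) →
      ∀ (f : LGConfig d (SUN N) → ℝ), Measurable f → (∃ B, ∀ σ, |f σ| ≤ B) →
        DependsOn f (starWinZd c : Set (ZdEdge d)) →
        ∫ σ, f σ ∂(γ (starWinZd c) ζ) = ∫ σ, f σ ∂(γ (starWinZd c) ζ'))
    (hρ0 : 0 ≤ ρ) (hρ1 : ρ < 1) (hwin : StarWindowBoundZdR d N γ D ρ suFrobDist) (hμ : IsGibbsMeasure γ μ)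
    {t : ℝ} (ht : t = -Real.log (max ρ (1 / 2)) / (D + 2 : ℕ))
    {f : LGConfig d (SUN N) → ℝ} (hfm : Measurable f) {Δf : Finset (ZdEdge d)}
    (hfdep : DependsOn f (↑Δf : Set (ZdEdge d))) {Mf : ℝ} (hMf : ∀ σ, |f σ| ≤ Mf) {δf : ZdEdge d → ℝ} (hδf : IsLipBound suFrobDist f δf)
    {g : LGConfig d (SUN N) → ℝ} (hgm : Measurable g) {Δg : Finset (ZdEdge d)}
    (hgdep : DependsOn g (↑Δg : Set (ZdEdge d))) {Mg : ℝ} (hMg : ∀ σ, |g σ| ≤ Mg) {δg : ZdEdge d → ℝ} (hδg : IsLipBound suFrobDist g δg)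
    {h : LGConfig d (SUN N) → ℝ} (hhm : Measurable h) {Δh : Finset (ZdEdge d)}
    (hhdep : DependsOn h (↑Δh : Set (ZdEdge d))) {Mh : ℝ} (hMh : ∀ σ, |h σ| ≤ Mh) {δh : ZdEdge d → ℝ} (hδh : IsLipBound suFrobDist h δh) :
    |cov[fun σ => f σ * g σ, h; μ] - (∫ σ, f σ ∂μ) * cov[g, h; μ] - (∫ σ, g σ ∂μ) * cov[f, h; μ]| ≤
      16 * N * (max ρ (1 / 2))⁻¹ * ((Mf * ∑ y ∈ Δg, δg y + Mg * ∑ y ∈ Δf, δf y) * (∑ y ∈ Δh, δh y) +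
          (Mf * ∑ y ∈ Δh, δh y + Mh * ∑ y ∈ Δf, δf y) * (∑ y ∈ Δg, δg y) +
          (Mg * ∑ y ∈ Δh, δh y + Mh * ∑ y ∈ Δg, δg y) * (∑ y ∈ Δf, δf y)) *
        ((exp (-(t / 3 * setDistEdges Δf Δh)) + exp (-(t / 3 * setDistEdges Δg Δh))) *
          (exp (-(t / 3 * setDistEdges Δf Δg)) + exp (-(t / 3 * setDistEdges Δh Δg))) *
          (exp (-(t / 3 * setDistEdges Δg Δf)) + exp (-(t / 3 * setDistEdges Δh Δf)))) := by
  classical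
  haveI := hμ.isProbabilityMeasure
  have hMf0 : 0 ≤ Mf := (abs_nonneg _).trans (hMf 1); have hMg0 : 0 ≤ Mg := (abs_nonneg _).trans (hMg 1)
  have hMh0 : 0 ≤ Mh := (abs_nonneg _).trans (hMh 1)
  have hSf : 0 ≤ ∑ y ∈ Δf, δf y := sum_nonneg fun y _ => hδf.nonneg y; have hSg : 0 ≤ ∑ y ∈ Δg, δg y := sum_nonneg fun y _ => hδg.nonneg y
  have hSh : 0 ≤ ∑ y ∈ Δh, δh y := sum_nonneg fun y _ => hδh.nonneg y
  -- the rate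
  set ρ' : ℝ := max ρ (1 / 2) with hρ'
  have hρ'0 : 0 < ρ' := lt_of_lt_of_le (by norm_num) (le_max_right _ _)
  have hρ'1 : ρ' < 1 := max_lt hρ1 (by norm_num)
  have hlogneg : 0 < -Real.log ρ' := by have := Real.log_neg hρ'0 hρ'1; linarith
  have htpos : 0 < t := by rw [ht]; exact div_pos hlogneg (by positivity)
  have ht0 : 0 ≤ t := htpos.le
  have hC0 : (0 : ℝ) ≤ 16 * N * ρ'⁻¹ := by positivity
  obtain ⟨B₁, hB₁⟩ : ∃ x : ℝ, x = (Mf * ∑ y ∈ Δg, δg y + Mg * ∑ y ∈ Δf, δf y) * ∑ y ∈ Δh, δh y := ⟨_, rfl⟩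
  obtain ⟨B₂, hB₂⟩ : ∃ x : ℝ, x = (Mf * ∑ y ∈ Δh, δh y + Mh * ∑ y ∈ Δf, δf y) * ∑ y ∈ Δg, δg y := ⟨_, rfl⟩
  obtain ⟨B₃, hB₃⟩ : ∃ x : ℝ, x = (Mg * ∑ y ∈ Δh, δh y + Mh * ∑ y ∈ Δg, δg y) * ∑ y ∈ Δf, δf y := ⟨_, rfl⟩
  have hB₁0 : 0 ≤ B₁ := by rw [hB₁]; positivity
  have hB₂0 : 0 ≤ B₂ := by rw [hB₂]; positivity
  have hB₃0 : 0 ≤ B₃ := by rw [hB₃]; positivity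
  obtain ⟨m₁, hm₁⟩ : ∃ x : ℝ, x = setDistEdges (Δf ∪ Δg) Δh := ⟨_, rfl⟩
  obtain ⟨m₂, hm₂⟩ : ∃ x : ℝ, x = setDistEdges (Δf ∪ Δh) Δg := ⟨_, rfl⟩
  obtain ⟨m₃, hm₃⟩ : ∃ x : ℝ, x = setDistEdges (Δg ∪ Δh) Δf := ⟨_, rfl⟩
  -- floor powers dominated by exponentials at rate `t`
  have hpow : ∀ m : ℝ, ρ ^ ⌊m / (D + 2 : ℕ)⌋₊ ≤ ρ'⁻¹ * exp (-(t * m)) := fun m => by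
    have hp := pow_floor_le_exp (x := m) hρ0 hρ1 D
    rw [← hρ'] at hp
    have : -(-Real.log ρ' / (D + 2 : ℕ)) * m = -(t * m) := by rw [ht]; ring
    rwa [this] at hp
  -- the three splits
  have s1 : |cov[fun σ => f σ * g σ, h; μ] - (∫ σ, f σ ∂μ) * cov[g, h; μ] - (∫ σ, g σ ∂μ) * cov[f, h; μ]| ≤
      16 * N * ρ'⁻¹ * B₁ * exp (-(t * m₁)) := by
    have h1 := abs_threePoint_le_split_star hγ hD hloc hρ0 hρ1 hwin hμ hfm hfdep hMf hδf hgm hgdep hMg hδg hhm hhdep hMh hδh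
    rw [← hm₁] at h1
    calc _ ≤ 16 * N * B₁ * ρ ^ ⌊m₁ / (D + 2 : ℕ)⌋₊ := by rw [hB₁]; linarith
      _ ≤ 16 * N * B₁ * (ρ'⁻¹ * exp (-(t * m₁))) := mul_le_mul_of_nonneg_left (hpow m₁) (by positivity)
      _ = _ := by ring
  have s2 : |cov[fun σ => f σ * g σ, h; μ] - (∫ σ, f σ ∂μ) * cov[g, h; μ] - (∫ σ, g σ ∂μ) * cov[f, h; μ]| ≤
      16 * N * ρ'⁻¹ * B₂ * exp (-(t * m₂)) := by
    have h1 := abs_threePoint_le_split_star hγ hD hloc hρ0 hρ1 hwin hμ hfm hfdep hMf hδf hhm hhdep hMh hδh hgm hgdep hMg hδg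
    rw [← hm₂, ← threePoint_swap hfm hgm hhm hMf hMg hMh] at h1
    calc _ ≤ 16 * N * B₂ * ρ ^ ⌊m₂ / (D + 2 : ℕ)⌋₊ := by rw [hB₂]; linarith
      _ ≤ 16 * N * B₂ * (ρ'⁻¹ * exp (-(t * m₂))) := mul_le_mul_of_nonneg_left (hpow m₂) (by positivity)
      _ = _ := by ring
  have s3 : |cov[fun σ => f σ * g σ, h; μ] - (∫ σ, f σ ∂μ) * cov[g, h; μ] - (∫ σ, g σ ∂μ) * cov[f, h; μ]| ≤
      16 * N * ρ'⁻¹ * B₃ * exp (-(t * m₃)) := by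
    have h1 := abs_threePoint_le_split_star hγ hD hloc hρ0 hρ1 hwin hμ hgm hgdep hMg hδg hhm hhdep hMh hδh hfm hfdep hMf hδf
    rw [← hm₃, ← threePoint_rotate hfm hgm hhm hMf hMg hMh] at h1
    calc _ ≤ 16 * N * B₃ * ρ ^ ⌊m₃ / (D + 2 : ℕ)⌋₊ := by rw [hB₃]; linarith
      _ ≤ 16 * N * B₃ * (ρ'⁻¹ * exp (-(t * m₃))) := mul_le_mul_of_nonneg_left (hpow m₃) (by positivity)
      _ = _ := by ring
  -- the best split: the largest of `m₁, m₂, m₃` is at least their mean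
  obtain ⟨U, hU⟩ : ∃ x : ℝ, x = |cov[fun σ => f σ * g σ, h; μ] - (∫ σ, f σ ∂μ) * cov[g, h; μ] - (∫ σ, g σ ∂μ) * cov[f, h; μ]| :=
    ⟨_, rfl⟩
  rw [← hU] at s1 s2 s3 ⊢
  obtain ⟨Bt, hBt⟩ : ∃ x : ℝ, x = B₁ + B₂ + B₃ := ⟨_, rfl⟩
  have hBt0 : 0 ≤ Bt := by rw [hBt]; positivity
  have key : ∀ {B m : ℝ}, B ≤ Bt → U ≤ 16 * N * ρ'⁻¹ * B * exp (-(t * m)) → m₁ + m₂ + m₃ ≤ 3 * m →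
      U ≤ 16 * N * ρ'⁻¹ * Bt * exp (-(t / 3 * (m₁ + m₂ + m₃))) := by
    intro B m hB hUB hm
    have h1 : exp (-(t * m)) ≤ exp (-(t / 3 * (m₁ + m₂ + m₃))) := by
      refine exp_le_exp.2 ?_
      have := mul_le_mul_of_nonneg_left hm ht0
      linarith
    calc U ≤ 16 * N * ρ'⁻¹ * B * exp (-(t * m)) := hUB
      _ ≤ 16 * N * ρ'⁻¹ * Bt * exp (-(t / 3 * (m₁ + m₂ + m₃))) :=
          mul_le_mul (mul_le_mul_of_nonneg_left hB hC0) h1 (exp_pos _).le (mul_nonneg hC0 hBt0)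
  have hmean : U ≤ 16 * N * ρ'⁻¹ * Bt * exp (-(t / 3 * (m₁ + m₂ + m₃))) := by
    by_cases h1 : m₁ + m₂ + m₃ ≤ 3 * m₁
    · exact key (by rw [hBt]; linarith) s1 h1
    · by_cases h2 : m₁ + m₂ + m₃ ≤ 3 * m₂
      · exact key (by rw [hBt]; linarith) s2 h2
      · exact key (by rw [hBt]; linarith) s3 (by rw [not_le] at h1 h2; linarith)
  -- each union distance dominates the minimum of two single distances
  have ht3 : 0 ≤ t / 3 := by positivity
  have f1 : exp (-(t / 3 * m₁)) ≤ exp (-(t / 3 * setDistEdges Δf Δh)) + exp (-(t / 3 * setDistEdges Δg Δh)) :=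
    hm₁ ▸ exp_neg_setDistEdges_union_le ht3 Δf Δg Δh
  have f2 : exp (-(t / 3 * m₂)) ≤ exp (-(t / 3 * setDistEdges Δf Δg)) + exp (-(t / 3 * setDistEdges Δh Δg)) :=
    hm₂ ▸ exp_neg_setDistEdges_union_le ht3 Δf Δh Δg
  have f3 : exp (-(t / 3 * m₃)) ≤ exp (-(t / 3 * setDistEdges Δg Δf)) + exp (-(t / 3 * setDistEdges Δh Δf)) :=
    hm₃ ▸ exp_neg_setDistEdges_union_le ht3 Δg Δh Δf
  have hsplit : exp (-(t / 3 * (m₁ + m₂ + m₃))) = exp (-(t / 3 * m₁)) * exp (-(t / 3 * m₂)) * exp (-(t / 3 * m₃)) := by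
    rw [← Real.exp_add, ← Real.exp_add]; congr 1; ring
  have g1 := (exp_pos (-(t / 3 * m₁))).le; have g2 := (exp_pos (-(t / 3 * m₂))).le; have g3 := (exp_pos (-(t / 3 * m₃))).le
  have hprod : exp (-(t / 3 * m₁)) * exp (-(t / 3 * m₂)) * exp (-(t / 3 * m₃)) ≤
      (exp (-(t / 3 * setDistEdges Δf Δh)) + exp (-(t / 3 * setDistEdges Δg Δh))) *
        (exp (-(t / 3 * setDistEdges Δf Δg)) + exp (-(t / 3 * setDistEdges Δh Δg))) *
        (exp (-(t / 3 * setDistEdges Δg Δf)) + exp (-(t / 3 * setDistEdges Δh Δf))) :=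
    mul_le_mul (mul_le_mul f1 f2 g2 (g1.trans f1)) f3 g3 (mul_nonneg (g1.trans f1) (g2.trans f2))
  calc U ≤ 16 * N * ρ'⁻¹ * Bt * exp (-(t / 3 * (m₁ + m₂ + m₃))) := hmean
    _ = 16 * N * ρ'⁻¹ * Bt * (exp (-(t / 3 * m₁)) * exp (-(t / 3 * m₂)) * exp (-(t / 3 * m₃))) := by rw [hsplit]
    _ ≤ 16 * N * ρ'⁻¹ * Bt * ((exp (-(t / 3 * setDistEdges Δf Δh)) + exp (-(t / 3 * setDistEdges Δg Δh))) *
        (exp (-(t / 3 * setDistEdges Δf Δg)) + exp (-(t / 3 * setDistEdges Δh Δg))) *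
        (exp (-(t / 3 * setDistEdges Δg Δf)) + exp (-(t / 3 * setDistEdges Δh Δf)))) :=
        mul_le_mul_of_nonneg_left hprod (mul_nonneg hC0 hBt0)
    _ = _ := by rw [hBt, hB₁, hB₂, hB₃]

end Star

/-! ### The third cumulant in the DLR states of a tier-1 member -/

section Member

variable {W : Potential (ZdEdge d) (SUN N)} {supp : Finset (ZdEdge d) → Finset (Finset (ZdEdge d))}

/-- **TREE DECAY OF THE THIRD CUMULANT FOR A TIER-1 MEMBER THROUGH THE STAR DOOR.**  Member `(W, supp)` (continuous own-link terms of range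
`R`, star window bound with locality radius `D ≥ R + 2`, received sum `0 ≤ ρ < 1`), ANY DLR state `μ`, `t = log(1/max(ρ,½))/(D+2)`, three bounded
measurable local Frobenius-Lipschitz observables: the conclusion of `abs_threePoint_le_tree_star`. -/
theorem abs_threePoint_le_tree_of_member (hd : 1 ≤ d) {β ρ : ℝ} {R D : ℕ}
    (hWc : ∀ X, Continuous (W X)) (hWdep : ∀ X, DependsOn (W X) (↑X : Set (ZdEdge d))) (hsupp : W.IsSupportedBy supp)
    (hR : ∀ e, ∀ X ∈ supp {e}, e ∈ X → ∀ y ∈ X, ‖e.1 - y.1‖ ≤ (R : ℝ)) (hD : R + 2 ≤ D) (hρ0 : 0 ≤ ρ) (hρ1 : ρ < 1)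
    (hwin : StarWindowBoundZdR d N (perturbedYM (d := d) (fundamentalRep (Fin N)) (N * β) W supp) D ρ suFrobDist)
    {μ : Measure (LGConfig d (SUN N))} (hμ : μ ∈ perturbedGibbsMeasures (d := d) (fundamentalRep (Fin N)) (N * β) W supp)
    {t : ℝ} (ht : t = -Real.log (max ρ (1 / 2)) / (D + 2 : ℕ))
    {f : LGConfig d (SUN N) → ℝ} (hfm : Measurable f) {Δf : Finset (ZdEdge d)}
    (hfdep : DependsOn f (↑Δf : Set (ZdEdge d))) {Mf : ℝ} (hMf : ∀ σ, |f σ| ≤ Mf) {δf : ZdEdge d → ℝ} (hδf : IsLipBound suFrobDist f δf)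
    {g : LGConfig d (SUN N) → ℝ} (hgm : Measurable g) {Δg : Finset (ZdEdge d)}
    (hgdep : DependsOn g (↑Δg : Set (ZdEdge d))) {Mg : ℝ} (hMg : ∀ σ, |g σ| ≤ Mg) {δg : ZdEdge d → ℝ} (hδg : IsLipBound suFrobDist g δg)
    {h : LGConfig d (SUN N) → ℝ} (hhm : Measurable h) {Δh : Finset (ZdEdge d)}
    (hhdep : DependsOn h (↑Δh : Set (ZdEdge d))) {Mh : ℝ} (hMh : ∀ σ, |h σ| ≤ Mh) {δh : ZdEdge d → ℝ} (hδh : IsLipBound suFrobDist h δh) :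
    |cov[fun σ => f σ * g σ, h; μ] - (∫ σ, f σ ∂μ) * cov[g, h; μ] - (∫ σ, g σ ∂μ) * cov[f, h; μ]| ≤
      16 * N * (max ρ (1 / 2))⁻¹ * ((Mf * ∑ y ∈ Δg, δg y + Mg * ∑ y ∈ Δf, δf y) * (∑ y ∈ Δh, δh y) +
          (Mf * ∑ y ∈ Δh, δh y + Mh * ∑ y ∈ Δf, δf y) * (∑ y ∈ Δg, δg y) +
          (Mg * ∑ y ∈ Δh, δh y + Mh * ∑ y ∈ Δg, δg y) * (∑ y ∈ Δf, δf y)) *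
        ((exp (-(t / 3 * setDistEdges Δf Δh)) + exp (-(t / 3 * setDistEdges Δg Δh))) *
          (exp (-(t / 3 * setDistEdges Δf Δg)) + exp (-(t / 3 * setDistEdges Δh Δg))) *
          (exp (-(t / 3 * setDistEdges Δg Δf)) + exp (-(t / 3 * setDistEdges Δh Δf)))) := by
  haveI : SecondCountableTopology (Matrix (Fin N) (Fin N) ℂ) :=
    inferInstanceAs (SecondCountableTopology (Fin N → Fin N → ℂ))
  haveI : SecondCountableTopology (SUN N) := Topology.IsEmbedding.subtypeVal.secondCountableTopology
  have hW : W.IsAdapted := fun X => ⟨hWdep X, (hWc X).measurable⟩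
  have hWb : ∀ X, ∃ C, ∀ U, |W X U| ≤ C := fun X => exists_bound_of_continuous (hWc X)
  have hγ : IsSpecification (perturbedYM (d := d) (fundamentalRep (Fin N)) (N * β) W supp) :=
    isSpecification_perturbedYM _ (continuous_fundamentalRep (Fin N)) _ hW hWb hsupp
  have hμ' : IsGibbsMeasure (perturbedYM (d := d) (fundamentalRep (Fin N)) (N * β) W supp) μ := hμ
  have hD1 : 1 ≤ D := by omega
  have hloc : ∀ (c : ZdEdge d) (ζ ζ' : LGConfig d (SUN N)), (∀ v ∈ starNbhdZdR D c.1, ζ v = ζ' v) →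
      ∀ (g : LGConfig d (SUN N) → ℝ), Measurable g → (∃ B, ∀ σ, |g σ| ≤ B) →
        DependsOn g (starWinZd c : Set (ZdEdge d)) →
        ∫ σ, g σ ∂(perturbedYM (d := d) (fundamentalRep (Fin N)) (N * β) W supp (starWinZd c) ζ) =
          ∫ σ, g σ ∂(perturbedYM (d := d) (fundamentalRep (Fin N)) (N * β) W supp (starWinZd c) ζ') :=
    fun c ζ ζ' hζ g hgm _ hgdep => perturbed_star_hloc _ (continuous_fundamentalRep (Fin N)) _
      (fun X => (hWc X).measurable) hWdep hsupp hR hD c ζ ζ' hζ g hgm hgdep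
  have _h := hd
  exact abs_threePoint_le_tree_star hγ hD1 hloc hρ0 hρ1 hwin hμ' ht hfm hfdep hMf hδf hgm hgdep hMg hδg hhm hhdep hMh hδh

end Member

/-! ### `SU(2)`, `ℤ⁴`: the Wilson point up to `β_W = 1/3` -/

/-- ★ **THE `SU(2)` WILSON POINT ON `ℤ⁴`, EVERY `0 ≤ β_W ≤ 1/3`: TREE DECAY OF THE THIRD CUMULANT OF LIPSCHITZ CYLINDERS** (received sum
`≤ 399/400` along the segment, star radius `D = 3`, rate `t = log(400/399)/5`, `s = t/3`).  For every DLR state `μ` at `β_W` (bare coupling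
`β_W/2`) and cylinders `F, G, H` (supports `Λ_•`, constants `K_•`, bounds `M_•`):
`|u₃(F; G; H)| ≤ 32·(400/399)·B₃ · (e^{−s d(Λ_F,Λ_H)} + e^{−s d(Λ_G,Λ_H)})(e^{−s d(Λ_F,Λ_G)} + e^{−s d(Λ_H,Λ_G)})(e^{−s d(Λ_G,Λ_F)} + e^{−s d(Λ_H,Λ_F)})`,
`B₃ = (M_F #Λ_G K_G + M_G #Λ_F K_F) #Λ_H K_H + (M_F #Λ_H K_H + M_H #Λ_F K_F) #Λ_G K_G + (M_G #Λ_H K_H + M_H #Λ_G K_G) #Λ_F K_F`. -/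
theorem su2_wilson_abs_threePoint_le_tree_upTo_oneThird {βW : ℝ} (h0 : 0 ≤ βW) (h1 : βW ≤ 1 / 3)
    {μ : Measure (LGConfig 4 (SUN 2))} (hμ : μ ∈ ymGibbsMeasures (d := 4) (fundamentalRep (Fin 2)) (2 * (βW / 4)))
    {F : LGConfig 4 (SUN 2) → ℝ} {ΛF : Finset (ZdEdge 4)} {KF : ℝ≥0} (hF : IsLipschitzCylinder (fundamentalRep (Fin 2)) F ΛF KF)
    {MF : ℝ} (hMF : ∀ σ, |F σ| ≤ MF)
    {G : LGConfig 4 (SUN 2) → ℝ} {ΛG : Finset (ZdEdge 4)} {KG : ℝ≥0} (hG : IsLipschitzCylinder (fundamentalRep (Fin 2)) G ΛG KG)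
    {MG : ℝ} (hMG : ∀ σ, |G σ| ≤ MG)
    {H : LGConfig 4 (SUN 2) → ℝ} {ΛH : Finset (ZdEdge 4)} {KH : ℝ≥0} (hH : IsLipschitzCylinder (fundamentalRep (Fin 2)) H ΛH KH)
    {MH : ℝ} (hMH : ∀ σ, |H σ| ≤ MH) :
    |cov[fun σ => F σ * G σ, H; μ] - (∫ σ, F σ ∂μ) * cov[G, H; μ] - (∫ σ, G σ ∂μ) * cov[F, H; μ]| ≤
      32 * (400 / 399) * ((MF * (ΛG.card * KG) + MG * (ΛF.card * KF)) * (ΛH.card * KH) +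
          (MF * (ΛH.card * KH) + MH * (ΛF.card * KF)) * (ΛG.card * KG) +
          (MG * (ΛH.card * KH) + MH * (ΛG.card * KG)) * (ΛF.card * KF)) *
        ((exp (-(Real.log (400 / 399) / 5 / 3 * setDistEdges ΛF ΛH)) + exp (-(Real.log (400 / 399) / 5 / 3 * setDistEdges ΛG ΛH))) *
          (exp (-(Real.log (400 / 399) / 5 / 3 * setDistEdges ΛF ΛG)) + exp (-(Real.log (400 / 399) / 5 / 3 * setDistEdges ΛH ΛG))) *
          (exp (-(Real.log (400 / 399) / 5 / 3 * setDistEdges ΛG ΛF)) + exp (-(Real.log (400 / 399) / 5 / 3 * setDistEdges ΛH ΛF)))) := by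
  classical
  -- the zero member of `MemBallZdG (3/125) (3/250) 0` and its star window bound at received sum `≤ 399/400`
  have hmem : MemBallZdG (N := 2) (d := 4) (3 / 125) (3 / 250) 0 0 (fun _ => (∅ : Finset (Finset (ZdEdge 4)))) :=
    memBallZdG_zero (by norm_num) (by norm_num) 0
  have habs : |((2 : ℕ) : ℝ) * (βW / 4)| / ((2 : ℕ) : ℝ) = βW / 4 := by
    rw [abs_of_nonneg (by positivity)]; push_cast; ring
  have hR : |((2 : ℕ) : ℝ) * (βW / 4)| / ((2 : ℕ) : ℝ) * (2 * (((4 : ℕ) : ℝ) - 1)) ≤ 3 * βW / 2 := by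
    rw [habs]; push_cast; linarith
  have hc' : (1 : ℝ) * Real.exp (3 / 125) * (1 + 2 * Real.sqrt ((2 : ℕ) : ℝ) * (3 / 250)) *
      (|((2 : ℕ) : ℝ) * (βW / 4)| / ((2 : ℕ) : ℝ)) ≤ 17651 / 200000 := by
    have h2 : Real.sqrt ((2 : ℕ) : ℝ) = Real.sqrt 2 := by norm_num
    rw [h2, one_mul, habs]
    have hb : 0 ≤ βW / 4 := by positivity
    calc Real.exp (3 / 125) * (1 + 2 * Real.sqrt 2 * (3 / 250)) * (βW / 4)
        ≤ 1024291 / 1000000 * (1 + 2 * 1.41422 * (3 / 250)) * ((1 / 3) / 4) := by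
          gcongr
          · exact exp_le_3_125_star
          · exact sqrt_two_le
      _ ≤ 17651 / 200000 := by norm_num
  have hlam' : Real.sqrt ((2 : ℕ) : ℝ) * (3 / 250 : ℝ) ≤ 16971 / 1000000 := by
    have h2 : Real.sqrt ((2 : ℕ) : ℝ) = Real.sqrt 2 := by norm_num
    rw [h2]; nlinarith [sqrt_two_le, Real.sqrt_nonneg 2]
  have hwin := (starWindowBoundZdR_of_memBallZdG (d := 4) (N := 2) (by norm_num) (by norm_num) zero_le_one hR
    (su2_quarterModulus (h1.trans (by norm_num))) (by norm_num) hc' hlam' (θ := 6 * (17651 / 200000) + 16971 / 1000000)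
    (by push_cast; ring) (by norm_num) (by unfold doorPoly; norm_num) (Kn := 20)
    (ρ := gaugeR 4 (17651 / 200000) + (16971 / 1000000 + (6 * (17651 / 200000) + 16971 / 1000000) ^ 20 * (4 * 4 * (16971 / 1000000))) /
      (1 - (6 * (17651 / 200000) + 16971 / 1000000))) (by push_cast; ring) hmem).mono_rho
    (show _ ≤ (399 / 400 : ℝ) by unfold gaugeR Delta; norm_num)
  have hμ' : μ ∈ perturbedGibbsMeasures (d := 4) (fundamentalRep (Fin 2)) ((2 : ℕ) * (βW / 4))
      (0 : Potential (ZdEdge 4) (SUN 2)) (fun _ => ∅) := by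
    rw [perturbedGibbsMeasures_zero]; exact_mod_cast hμ
  have hA : ∀ a b : SUN 2, dist (suEntries a) (suEntries b) ≤ 1 * suFrobDist a b :=
    fun a b => by rw [one_mul]; exact dist_suEntries_le_suFrobDist a b
  have ht : Real.log (400 / 399) / 5 = -Real.log (max (399 / 400 : ℝ) (1 / 2)) / ((max 0 1 + 2 : ℕ) + 2 : ℕ) := by
    rw [max_eq_left (by norm_num : (1 / 2 : ℝ) ≤ 399 / 400), ← Real.log_inv]; norm_num
  have key := abs_threePoint_le_tree_of_member (N := 2) (d := 4) (by norm_num) hmem.continuous hmem.dependsOn hmem.supportedBy hmem.range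
    (show 0 + 2 ≤ max 0 1 + 2 by norm_num) (by norm_num) (by norm_num) hwin hμ' ht hF.measurable hF.dependsOn hMF
    (hF.isLipBound zero_le_one hA) hG.measurable hG.dependsOn hMG (hG.isLipBound zero_le_one hA) hH.measurable hH.dependsOn hMH
    (hH.isLipBound zero_le_one hA)
  have hsum : ∀ (Λ₀ : Finset (ZdEdge 4)) (K : ℝ≥0), ∑ y ∈ Λ₀, (if y ∈ Λ₀ then (1 : ℝ) * (K : ℝ) else 0) = Λ₀.card * K := fun Λ₀ K => by
    rw [Finset.sum_congr rfl fun y hy => by rw [if_pos hy, one_mul], Finset.sum_const, nsmul_eq_mul]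
  rw [hsum, hsum, hsum, max_eq_left (by norm_num : (1 / 2 : ℝ) ≤ 399 / 400)] at key
  refine key.trans (le_of_eq ?_)
  norm_num

end Summit.Ventures.YMGap.RobustBall

end
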